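import Summits.QuantumAdvantage.QuantumAdvantage.Theorems.WbwObfuscatedGluedTreesKowPhTransducer
import Summits.QuantumAdvantage.QuantumAdvantage.Theorems.WbwObfuscatedGluedTreesKowPhPrimSem
import Summits.QuantumAdvantage.QuantumAdvantage.Theorems.WbwObfuscatedGluedTreesKowPhPrimFP
import Summits.QuantumAdvantage.QuantumAdvantage.Theorems.WbwObfuscatedGluedTreesKowPhWalkSem
import Summits.QuantumAdvantage.QuantumAdvantage.Theorems.WbwObfuscatedGluedTreesKowPhWalkFPQ
import Summits.QuantumAdvantage.QuantumAdvantage.Theorems.WbwObfuscatedGluedTreesKowPhWalkFPOut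
import Summits.QuantumAdvantage.QuantumAdvantage.Theorems.WbwObfuscatedGluedTreesKowPhOuter
import Literature.Computability.Complexity.OracleSubroutine

/-!
# Stub `stub_reduction` — the PRF distinguisher of stage 7, assembled (crux `WbwObfuscatedGluedTrees`,
# stmt-QuantumAdvantage-2340; line `knowledge-of-walk-split`, STAGE 7, the PRF hybrid; lead prover-line-stmt-QuantumAdvantage-2340-c6-0)

From the seven landed stubs of the wave — the adaptive transducer (`stub_transducer`), layer B (`stub_primSem`,
`stub_primFP`: SIV encryption / name recognition / keyed Feistel permutations over four table lookups), layer C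
(`stub_walkSem`, `stub_walkFPQ`, `stub_walkFPOut`: the walk requests over seven layer-B requests) and the walker wrapper
(`stub_outer`) — ONE probabilistic polynomial-time Boolean oracle adversary `ℬ` is assembled by two applications of the
tree's subroutine theorem `OracleAlg.exists_polyTime_subroutine` (Ladner–Lynch–Selman / Arora–Barak: call a clocked
polynomial-time oracle machine as a subroutine, polynomially often, relative to ANY oracle): `ℬ = wrapper ∘ (layer C ∘
layer B)`.  Against EVERY oracle `O`, on `⟨1ⁿ, r⟩`, `ℬ` decides exactly whether the walker `𝒜` (coins `r`) wins the
black-box walk game on the ideal-II instance `(codeCycle T d, codeNaming T d)` of the tables `T = tabOf μ O` read off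
`O` — which is the real instance when `O` is the PRF oracle of the scheduled product ensemble, and a uniform ideal-II
instance when `O` is a uniformly random function (the two games, `stub_gameReal` / `stub_gameIdeal`).

§1 records the size bookkeeping the subroutine theorem asks for (every layer-C request is a layer-B request
`mkReq Λ n body` of length linear in `μ + d`, every layer-B answer is a `primSpec` value of length `≤ μ + d + |body| + 1`),
§2 the two machines of layers B and C with their semantics against arbitrary oracles, §3 the assembly.
-/

set_option linter.dupNamespace false

noncomputable section

namespace Summit.QuantumAdvantage.QuantumAdvantage.Theorems.WbwObfuscatedGluedTrees.KnowledgeOfWalk.PrfHybrid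

open Literature.Computability.Complexity Literature.Computability.QuantumComplexity
open Literature.Computability.QuantumComplexity.GluedTrees
open Literature.Computability.Cryptography Literature.Computability.Cryptography.ObfuscatedGluedTrees
open Summit.QuantumAdvantage.QuantumAdvantage.Theorems.WbwObfuscatedGluedTrees.KnowledgeOfWalk.BlackBox
open Summit.QuantumAdvantage.QuantumAdvantage.Theorems.WbwObfuscatedGluedTrees.KnowledgeOfWalk.RealIdeal
open Literature.Computability.Complexity.CodeFP (unE pairE strE listE)
open _root_.Computability Polynomial

/-! ## §1 Size bookkeeping -/

/-- The answers of a straight-line program are the oracle's answers to its successive queries (listed form). [folklore] -/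
private theorem red_progAnswers_eq_map {α : Type} (Q : α → List (List Bool) → List Bool) (O : Oracle) (a : α) :
    ∀ j : ℕ, progAnswers Q O a j = (List.range j).map fun i => O (Q a (progAnswers Q O a i))
  | 0 => rfl
  | j + 1 => by
    rw [progAnswers_succ, List.range_succ, List.map_append, List.map_singleton, ← red_progAnswers_eq_map Q O a j]

/-- The second answer collected (if any) is the answer to the query after the first answer. [folklore] -/
private theorem red_progAnswers_getD_one {α : Type} (Q : α → List (List Bool) → List Bool) (O : Oracle) (a : α)
    (j : ℕ) : (progAnswers Q O a j).getD 1 [] = if 1 < j then O (Q a (progAnswers Q O a 1)) else [] := by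
  rw [red_progAnswers_eq_map, List.getD_eq_getElem?_getD, List.getElem?_map]
  split_ifs with h
  · rw [List.getElem?_range h]; rfl
  · rw [List.getElem?_eq_none (by simp; omega)]; rfl

/-- Every layer-B answer is short: `|primSpec μ d T body| ≤ μ + d + |body| + 1`. [folklore] -/
private theorem red_length_primSpec (μ d : ℕ) (T : CodeSpace μ) (body : List Bool) :
    (primSpec μ d T body).length ≤ μ + d + body.length + 1 := by
  unfold primSpec
  rcases body with _ | ⟨b₀, _ | ⟨b₁, rest⟩⟩
  · simp
  · cases b₀ <;> simp
  · cases b₀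
    · cases b₁
      · simp only [length_sivEnc, List.length_cons]; omega
      · simp only [List.length_cons]
        rcases h : unname (tabScheme T) μ (tkey 0) (tkey 1) d rest with _ | v
        · simp
        · simp only [Option.map_some, Option.getD_some, List.length_cons, length_label]
          -- a recognised name has the length of a name
          have hlen : rest.length = nameLen μ d := by
            have := (unname_eq_some_iff (tabScheme T) μ (tkey 0) (tkey 1) d rest v).1 h
            rw [← this, length_vname]
          unfold nameLen at hlen
          omega
    · rcases rest with _ | ⟨tb, w⟩
      · simp
      · simp only [List.length_ofFn, List.length_cons]; omega

/-- Every layer-C request is a layer-B request `mkReq Λ n body` whose body is at most `3 + N` plus the second answer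
received (the only answer a request body ever copies). [folklore] -/
private theorem red_walkQ_eq_mkReq (Λ : Params) (n : ℕ) (req : List Bool) (as : List (List Bool)) :
    ∃ body : List Bool, walkQ Λ (n, req) as = mkReq Λ n body ∧
      body.length ≤ 3 + nameLen (Λ.prfParam n) (Λ.depth n) + (as.getD 1 []).length := by
  have hN : labelLen (Λ.depth n) ≤ nameLen (Λ.prfParam n) (Λ.depth n) := by unfold nameLen; omega
  have hdN : Λ.depth n ≤ nameLen (Λ.prfParam n) (Λ.depth n) := by unfold nameLen labelLen; omega
  have hmk : ∀ s j i, (mkLabel (Λ.depth n) s j i).length = labelLen (Λ.depth n) := fun s j i => by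
    simp [mkLabel, labelLen]; ring
  unfold walkQ
  rcases req with _ | ⟨b₀, rest⟩
  · exact ⟨[], rfl, by simp⟩
  · cases b₀
    · rcases rest with _ | ⟨b₁, q⟩
      · exact ⟨[], rfl, by simp⟩
      · cases b₁
        · -- bit query
          simp only
          split_ifs with hq h0 hinv h3 hleaf hL
          · exact ⟨_, rfl, by simp only [List.length_cons, List.length_take]; omega⟩
          · exact ⟨[], rfl, by simp⟩
          · refine ⟨_, rfl, ?_⟩
            -- one of the three permutation bodies
            unfold prpBodies
            split_ifs <;>
            · rcases as.length - 1 with _ | _ | _ | k <;>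
                simp only [List.getD_cons_zero, List.getD_cons_succ, List.getD_nil, List.length_cons,
                  length_bitsOf, List.length_nil] <;> omega
          · exact ⟨[], rfl, by simp⟩
          · refine ⟨_, rfl, ?_⟩
            simp only [List.length_cons]
            have hall : ∀ ℓ ∈ nbrLabels (Λ.depth n) (as.getD 0 []).tail (as.getD 2 []) (as.getD 3 []),
                ℓ.length = labelLen (Λ.depth n) := by
              intro ℓ hℓ
              simp only [nbrLabels, List.mem_append] at hℓ
              rcases hℓ with hℓ | hℓ <;> split_ifs at hℓ <;>
                simp only [List.mem_cons, List.not_mem_nil, or_false] at hℓ <;>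
                rcases hℓ with rfl | rfl <;> exact hmk _ _ _
            have : ((nbrLabels (Λ.depth n) (as.getD 0 []).tail (as.getD 2 []) (as.getD 3 [])).getD (as.length - 4) []).length
                ≤ labelLen (Λ.depth n) := by
              rw [List.getD_eq_getElem?_getD]
              cases hget : (nbrLabels (Λ.depth n) (as.getD 0 []).tail (as.getD 2 []) (as.getD 3 []))[as.length - 4]? with
              | none => simp
              | some ℓ => simpa using (hall ℓ (List.mem_of_getElem? hget)).le
            omega
          · exact ⟨[], rfl, by simp⟩
          · exact ⟨[], rfl, by simp⟩
        · -- entrance request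
          simp only
          split_ifs
          · exact ⟨_, rfl, by simp only [List.length_cons, hmk]; omega⟩
          · exact ⟨[], rfl, by simp⟩
    · simp only
      split_ifs
      · exact ⟨_, rfl, by simp only [List.length_cons, hmk]; omega⟩
      · exact ⟨[], rfl, by simp⟩

/-- Length of a layer-B request. [folklore] -/
private theorem red_length_mkReq (Λ : Params) (n : ℕ) (body : List Bool) :
    (mkReq Λ n body).length = 4 * Λ.prfParam n + 2 * Λ.depth n + 6 + body.length := by
  simp only [mkReq, codeB, length_boolPair, CodeFP.length_unE (Λ.prfParam n), CodeFP.length_unE (Λ.depth n)]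
  ring

/-- Over-long walker queries are invisible to the request oracle beyond their first bit (`N ≥ 1`). [folklore] -/
private theorem red_walkOracle_cap {d N : ℕ} (hN : 1 ≤ N) (σ : CycleDatum d) (ν : NamingN d N) (u : List Bool)
    (hu : N + N + 1 < u.length) : walkOracle σ ν u = walkOracle σ ν [u.headD false] := by
  rcases u with _ | ⟨b, q⟩
  · simp at hu
  · cases b
    · simp only [List.headD_cons, walkOracle, bitOracle]
      simp only [List.length_cons] at hu
      rw [dif_neg (by omega), dif_neg (by simp; omega)]
    · rfl

/-- The winning bit read off a run: `decide (name(EXIT) <+: output, default [])` is `decide (WalkWin …)` (a name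
is non-empty, so a time-out never wins). [folklore] -/
private theorem red_decide_walkWin {d N : ℕ} (hN : 1 ≤ N) (A : OracleAlg (List Bool)) (k : ℕ) (w : List Bool)
    (σ : CycleDatum d) (ν : NamingN d N) :
    decide (List.ofFn (ν (GluedTrees.exit d)) <+: (A.run (walkOracle σ ν) k w).getD []) =
      decide (WalkWin A k w σ ν) := by
  rw [Bool.eq_iff_iff, decide_eq_true_iff, decide_eq_true_iff, walkWin_iff]
  rcases A.run (walkOracle σ ν) k w with _ | y
  · simp only [Option.getD_none, List.prefix_nil]
    have : List.ofFn (ν (GluedTrees.exit d)) ≠ [] := by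
      intro h; have := congrArg List.length h; simp at this; omega
    simp [this]
  · simp

/-! ## §2 The machines of layers B and C -/

/-- **Layer B as a polynomial-time oracle machine**: against EVERY oracle it answers a request `⟨⟨1^μ, 1^d⟩, body⟩`
within `5` rounds by the specification `primSpec μ d (tabOf μ O) body`. [folklore] -/
private theorem red_layerB :
    ∃ NB : OracleAlg (List Bool), NB.IsPolyTime (encodingList Bool) ∧
      ∀ (O : Oracle) (μ d : ℕ) (body : List Bool) (k : ℕ), 4 < k →
        NB.run O k (codeB ((μ, d), body)) = some (primSpec μ d (tabOf μ O) body) := by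
  obtain ⟨⟨FQ, hFQ, hQ⟩, ⟨FG, hFG, hG⟩⟩ := stub_primFP
  have hRQ : Realises codeB FQ (fun a : (ℕ × ℕ) × List Bool => fun as => primQ a.1.1 a.1.2 a.2 as) := fun a as => by
    have h := hQ (a, as); rw [CodeFP.listE_eq]; exact h
  have hRG : Realises codeB FG (fun a : (ℕ × ℕ) × List Bool => fun as => primOut a.1.1 a.1.2 a.2 as) := fun a as => by
    have h := hG (a, as); rw [CodeFP.listE_eq]; exact h
  refine ⟨adFnAlgL FQ FG 4, stub_transducer.1 FQ FG 4 hFQ hFG, fun O μ d body k hk => ?_⟩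
  rw [(stub_transducer.2 codeB _ _ FQ FG 4 hRQ hRG O ((μ, d), body) k hk).1]
  exact congrArg some (stub_primSem μ d O body)

/-- **Layer C as a polynomial-time oracle machine**: against EVERY oracle answering layer-B requests by the layer-B
specification of `T`, it answers a request `⟨1ⁿ, req⟩` within `8` rounds by `reqSpec (codeCycle T d) (codeNaming T d)
req`, asking only layer-B requests of length `≤ 7μ + 7d + 19`. [folklore] -/
private theorem red_layerC (Λ : Params) (hμ : CodeFP unE unE Λ.prfParam) (hd : CodeFP unE unE Λ.depth) :
    ∃ NC : OracleAlg (List Bool), NC.IsPolyTime (encodingList Bool) ∧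
      ∀ (O' : Oracle) (n : ℕ) (T : CodeSpace (Λ.prfParam n)),
        (∀ body : List Bool, O' (mkReq Λ n body) = primSpec (Λ.prfParam n) (Λ.depth n) T body) →
        ∀ (req : List Bool) (k : ℕ), 7 < k →
          NC.run O' k (codeC (n, req)) = some (reqSpec (codeCycle T (Λ.depth n)) (codeNaming T (Λ.depth n)) req) ∧
          ∀ y ∈ NC.queries O' k (codeC (n, req)), y.length ≤ 7 * Λ.prfParam n + 7 * Λ.depth n + 19 := by
  obtain ⟨FQ, hFQ, hQ⟩ := stub_walkFPQ Λ hμ hd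
  obtain ⟨FG, hFG, hG⟩ := stub_walkFPOut Λ hμ hd
  have hRQ : Realises codeC FQ (walkQ Λ) := fun a as => by
    have h := hQ (a, as); rw [CodeFP.listE_eq]; exact h
  have hRG : Realises codeC FG (walkOut Λ) := fun a as => by
    have h := hG (a, as); rw [CodeFP.listE_eq]; exact h
  refine ⟨adFnAlgL FQ FG 7, stub_transducer.1 FQ FG 7 hFQ hFG, fun O' n T hO' req k hk => ?_⟩
  obtain ⟨hrun, hq⟩ := stub_transducer.2 codeC _ _ FQ FG 7 hRQ hRG O' (n, req) k hk
  refine ⟨by rw [hrun, stub_walkSem Λ n O' T hO' req], fun y hy => ?_⟩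
  obtain ⟨j, hj, rfl⟩ := hq y hy
  obtain ⟨body, hbody, hlen⟩ := red_walkQ_eq_mkReq Λ n req (progAnswers (walkQ Λ) O' (n, req) j)
  rw [hbody, red_length_mkReq]
  -- the only copied answer is the second one, a `primSpec` value of a short body
  have h1 : ((progAnswers (walkQ Λ) O' (n, req) j).getD 1 []).length ≤
      Λ.prfParam n + Λ.depth n + nameLen (Λ.prfParam n) (Λ.depth n) + 4 := by
    rw [red_progAnswers_getD_one]
    split_ifs with h1j
    · obtain ⟨body₁, hbody₁, hlen₁⟩ := red_walkQ_eq_mkReq Λ n req (progAnswers (walkQ Λ) O' (n, req) 1)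
      rw [hbody₁, hO']
      rw [red_progAnswers_getD_one] at hlen₁
      simp only [lt_self_iff_false, if_false, List.length_nil, add_zero] at hlen₁
      have := red_length_primSpec (Λ.prfParam n) (Λ.depth n) T body₁
      omega
    · simp
  unfold nameLen labelLen at h1 hlen
  omega

/-! ## §3 The registered stub -/

/-- **Stub `stub_reduction`** of crux stmt-QuantumAdvantage-2340, line `knowledge-of-walk-split` (stage 7): one PPT
Boolean oracle adversary with the walker's coins that, against EVERY oracle `O`, decides exactly whether the walker wins
the walk game on the ideal-II instance of the tables read off `O` — the wrapper of `stub_outer` run over layer C run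
over layer B, composed twice by `OracleAlg.exists_polyTime_subroutine`. [cite: AroraBarak2009, §3.4] -/
theorem stub_reduction :
    ∀ (Λ : Params) (𝒜 : OracleAdversary (List Bool)),
      CodeFP unE unE Λ.prfParam → CodeFP unE unE Λ.depth →
      (∃ p : Polynomial ℕ, ∀ n, Λ.prfParam n ≤ p.eval n ∧ Λ.depth n ≤ p.eval n) →
      𝒜.IsPPT (encodingList Bool) →
      ∃ ℬ : OracleAdversary Bool, ℬ.IsPPT encodingBoolBool ∧ ℬ.coins = 𝒜.coins ∧
        ∀ (n : ℕ) (O : Oracle) (r : List Bool), r.length = 𝒜.coins.eval (gameInput n).length →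
          ℬ.alg.run O (ℬ.fuel.eval (gameInput n).length) (boolPair (gameInput n) r) =
            some (decide (WalkWin 𝒜.alg (𝒜.fuel.eval (gameInput n).length) (boolPair (gameInput n) r)
              (codeCycle (tabOf (Λ.prfParam n) O) (Λ.depth n)) (codeNaming (tabOf (Λ.prfParam n) O) (Λ.depth n)))) := by
  intro Λ 𝒜 hμ hd hpoly h𝒜
  obtain ⟨p, hp⟩ := hpoly
  obtain ⟨NB, hNBpoly, hNB⟩ := red_layerB
  obtain ⟨NC, hNCpoly, hNC⟩ := red_layerC Λ hμ hd
  obtain ⟨M, hMpoly, qM, hM⟩ := stub_outer Λ 𝒜 hμ hd h𝒜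
  -- layer C over layer B
  set Q₁ : Polynomial ℕ := C 14 * p + C 27 with hQ₁
  obtain ⟨C₁, hC₁poly, qC₁, hC₁⟩ := OracleAlg.exists_polyTime_subroutine hNCpoly hNBpoly Q₁ (C 5) []
  -- the wrapper over (layer C over layer B)
  obtain ⟨Cℬ, hCℬpoly, qC, hCℬ⟩ := OracleAlg.exists_polyTime_subroutine hMpoly hC₁poly qM qC₁ []
  refine ⟨⟨Cℬ, 𝒜.coins, qC.comp (C 2 * X + C 2 + 𝒜.coins)⟩, hCℬpoly, rfl, fun n O r hr => ?_⟩
  -- abbreviations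
  set μ := Λ.prfParam n with hμn
  set d := Λ.depth n with hdn
  set T : CodeSpace μ := tabOf μ O with hT
  set σ := codeCycle T d with hσ
  set ν := codeNaming T d with hν
  have hN1 : 1 ≤ nameLen μ d := by unfold nameLen labelLen; omega
  -- (1) layer B answers layer-B requests by the specification
  have hO' : ∀ body : List Bool, OracleAlg.subAnswer NB (C 5) [] O (mkReq Λ n body) = primSpec μ d T body := by
    intro body
    unfold OracleAlg.subAnswer
    rw [eval_C, show mkReq Λ n body = codeB ((μ, d), body) from rfl, hNB O μ d body 5 (by norm_num)]
    rfl
  -- (2) layer C over layer B answers walk requests by the specification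
  have hC₁run : ∀ req : List Bool,
      C₁.run O (qC₁.eval (codeC (n, req)).length) (codeC (n, req)) = some (reqSpec σ ν req) := by
    intro req
    have hlen : n ≤ (codeC (n, req)).length := by
      simp only [codeC, length_boolPair, show (unaryEncodeNat n).length = n from CodeFP.length_unE n]; omega
    have hQ₁ge : 7 < Q₁.eval (codeC (n, req)).length := by
      rw [hQ₁, eval_add, eval_mul, eval_C, eval_C]; omega
    obtain ⟨hrun, hq⟩ := hNC (OracleAlg.subAnswer NB (C 5) [] O) n T hO' req _ hQ₁ge
    refine (hC₁ O (codeC (n, req)) _ hrun fun y hy => (hq y hy).trans ?_).1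
    have hpn := hp n
    have hmono : p.eval n ≤ p.eval (codeC (n, req)).length := TM2Iter.eval_mono p hlen
    rw [hQ₁, eval_add, eval_mul, eval_C, eval_C]
    omega
  have hO'' : ∀ req : List Bool, OracleAlg.subAnswer C₁ qC₁ [] O (codeC (n, req)) = reqSpec σ ν req := fun req => by
    unfold OracleAlg.subAnswer; rw [hC₁run req]; rfl
  -- (3) the wrapper over (2)
  set x := boolPair (gameInput n) r with hx
  have hcap : ∀ u : List Bool, nameLen μ d + nameLen μ d + 1 < u.length →
      OracleAlg.subAnswer C₁ qC₁ [] O (codeC (n, false :: u)) =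
        OracleAlg.subAnswer C₁ qC₁ [] O (codeC (n, [false, u.headD false])) := fun u hu => by
    rw [hO'', hO'']
    exact red_walkOracle_cap hN1 σ ν u hu
  obtain ⟨hMrun, hMq⟩ := hM (OracleAlg.subAnswer C₁ qC₁ [] O) n r hcap
  have hfuel : (qC.comp (C 2 * X + C 2 + 𝒜.coins)).eval (gameInput n).length = qC.eval x.length := by
    simp only [eval_comp, eval_add, eval_mul, eval_C, eval_X, hx, length_boolPair, hr]
  rw [show (⟨Cℬ, 𝒜.coins, qC.comp (C 2 * X + C 2 + 𝒜.coins)⟩ : OracleAdversary Bool).alg = Cℬ from rfl,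
    show (⟨Cℬ, 𝒜.coins, qC.comp (C 2 * X + C 2 + 𝒜.coins)⟩ : OracleAdversary Bool).fuel =
      qC.comp (C 2 * X + C 2 + 𝒜.coins) from rfl, hfuel]
  refine ((hCℬ O x _ hMrun fun y hy => (hMq y hy).1).1).trans (congrArg some ?_)
  -- the decided bit is the winning bit
  have hwalk : (fun u => OracleAlg.subAnswer C₁ qC₁ [] O (codeC (n, false :: u))) = walkOracle σ ν :=
    funext fun u => hO'' (false :: u)
  rw [hO'', hwalk]
  exact red_decide_walkWin hN1 𝒜.alg _ x σ ν

end Summit.QuantumAdvantage.QuantumAdvantage.Theorems.WbwObfuscatedGluedTrees.KnowledgeOfWalk.PrfHybrid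

end
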